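import Summits.CriticalPhenomena.PercolationContinuityZ3.Theorems.PercNearOneGluingNoHeavyLowerTailSunflowerMultiPetalKempeTwoTerminal
import HarnessLib
import HarnessLib.Audit

/-!
# `NoHeavyLowerTail` (crux stmt-CriticalPhenomena-4575), Lemma B for graph clutters: VERTEX-DELETION MONOTONICITY of the
# two-terminal functional — the one-point kernel of `Tfun`, its pointwise facts, and the reduction `(VM) ⟹ (C*) ⟹ (C)`

Support file (seat `prim-l12-p2` gen 42; `--supports stmt-CriticalPhenomena-4575`; companion of `…SunflowerMultiPetalKempeTwoTerminal`
(p416807: `Tfun`, `TwoTerminalC`, Lemma B1) and `…SunflowerMultiPetalKempePinned` (p414773: `extCol`, `ctype_extCol`, `prof3`)).  No `sorry`;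
nothing is asserted about the crux; the `@[conjecture]` definition is an obligation of the programme, never a fact.
Memo: run/shared/lean/prim/prim-l12/prim-l12-p2/FINDING-g42-VERTEX-MONOTONICITY.md §1–§3.

THE STATEMENT (VM).  For the two-terminal functional `T(G;u,v) = Tfun G u v` (`= Σ_{σ u = 0, σ v = 1} fC (type σ)`) and every vertex
`y ∉ {u,v}`:  `T(G − y; u, v) ≤ T(G; u, v)`.  Exact enumeration (this gen): 0 failures over ALL simple graphs on ≤ 8 vertices (2 074 128
triples `(G,{u,v},y)`, connected or not; equality only when both sides vanish), over all marked multigraphs on ≤ 6 vertices (marks ≤ 1: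
0.98 M instances; multiplicities ≤ 2: 8.5 M comparisons) — whereas contraction- and identification-monotonicity fail for marked graphs and the
second-order (supermodular) version fails at `n = 7`.  Since `T` of the graph on the two terminals alone vanishes, (VM) gives `T(G;u,v) ≥ 0`
for EVERY finite graph by deleting the non-terminal vertices one at a time (`Tfun_nonneg_of_vertexMonotone`), in particular `TwoTerminalC`
(`twoTerminalC_of_vertexMonotone`), which by the gen-41 THEOREM R (memo FINDING-g41 §1) is the graph case of the inequality that yields Lemma B.

THE KERNEL.  As for `Q` (p414773), colourings of `V` are pairs (restriction to `V ∖ {y}`, colour of `y`), so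
`T(G) − T(G − y) = Σ_τ K_T(τ)` over the colourings `τ` of `V ∖ {y}` with `τ u = 0`, `τ v = 1` (`Tfun_sub_Tfun_induce`), with the kernel
`K_T(τ) = Σ_c fC (type (τ, y ↦ c)) − fC (type τ)` (`kerT`) `= kerTAbs (type τ) (profile τ)` (`kerT_eq_kerTAbs`) for the explicit
`kerTAbs t d = Σ_c fC (t ⊕ d_c e_c) − fC t`.  POINTWISE (finite checks): `kerTAbs t d ≥ 0` whenever no colour is absent from `N(y)`
(`kerTAbs_nonneg_of_ne_zero`) and whenever `y` carries ≥ 2 edges into each of two colour classes (`kerTAbs_nonneg_of_two_two*`); a negative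
kernel value forces an absent colour (`exists_eq_zero_of_kerTAbs_neg`).  The classes with an absent colour are NOT pointwise and not even
classwise nonnegative (memo §3: the pinned version of (VM) is false, exactly as for `PinnedMZ`'s two-terminal classes); (VM) is a global statement.
-/

namespace Summit.CriticalPhenomena.PercolationContinuityZ3.Theorems.SunflowerPartition.Kempe

open Finset
open scoped Classical

section Kernel

variable {V : Type*} [Fintype V] (G : SimpleGraph V) (y : V)

/-- The ONE-POINT KERNEL of the two-terminal functional: `K_T(τ) = Σ_c fC (type_G (τ, y ↦ c)) − fC (type_{G−y} τ)`. [this work] -/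
noncomputable def kerT (τ : (({y}ᶜ : Set V)) → Fin 3) : ℤ :=
  (∑ c : Fin 3, fC (ctype G (extCol y τ c))) - fC (ctype (G.induce ({y}ᶜ : Set V)) τ)

/-- The kernel as a function of the type `t` of `τ` in `G − y` and the capped colour profile `d` of `N(y)`:
`Σ_c fC (t ⊕ d_c e_c) − fC t`. [this work] -/
def kerTAbs (t d : CType) : ℤ :=
  fC (ctAdd t (xPart 0 d)) + fC (ctAdd t (xPart 1 d)) + fC (ctAdd t (xPart 2 d)) - fC t

/-- `K_T(τ) = kerTAbs (type τ) (profile τ)`. [this work] -/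
theorem kerT_eq_kerTAbs (τ : (({y}ᶜ : Set V)) → Fin 3) :
    kerT G y τ = kerTAbs (ctype (G.induce ({y}ᶜ : Set V)) τ) (prof3 G y τ) := by
  unfold kerT kerTAbs
  rw [Fin.sum_univ_three, ctype_extCol, ctype_extCol, ctype_extCol]

/-- If every colour occurs on `N(y)`, the kernel is pointwise nonnegative (finite check). [this work] -/
theorem kerTAbs_nonneg_of_ne_zero : ∀ t d : CType, d.1 ≠ 0 → d.2.1 ≠ 0 → d.2.2 ≠ 0 → 0 ≤ kerTAbs t d := by decide

/-- If `y` has ≥ 2 neighbours in each of the colour classes `0` and `1`, the kernel is pointwise nonnegative (finite check). [this work] -/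
theorem kerTAbs_nonneg_of_two_two_01 : ∀ t d : CType, d.1 = 2 → d.2.1 = 2 → 0 ≤ kerTAbs t d := by decide

/-- If `y` has ≥ 2 neighbours in each of the colour classes `0` and `2`, the kernel is pointwise nonnegative (finite check). [this work] -/
theorem kerTAbs_nonneg_of_two_two_02 : ∀ t d : CType, d.1 = 2 → d.2.2 = 2 → 0 ≤ kerTAbs t d := by decide

/-- If `y` has ≥ 2 neighbours in each of the colour classes `1` and `2`, the kernel is pointwise nonnegative (finite check). [this work] -/
theorem kerTAbs_nonneg_of_two_two_12 : ∀ t d : CType, d.2.1 = 2 → d.2.2 = 2 → 0 ≤ kerTAbs t d := by decide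

/-- A negative kernel value forces a colour to be absent from `N(y)` (finite check). [this work] -/
theorem exists_eq_zero_of_kerTAbs_neg : ∀ t d : CType, kerTAbs t d < 0 → d.1 = 0 ∨ d.2.1 = 0 ∨ d.2.2 = 0 := by decide

/-- The kernel of an ISOLATED `y` is `2·fC t`: deleting an isolated non-terminal divides `T` by three. [this work] -/
theorem kerTAbs_zero : ∀ t : CType, kerTAbs t (0, 0, 0) = 2 * fC t := by decide

/-- The kernel of a `y` PENDANT at a vertex of colour `0` is `fC (t ⊕ e_0) + fC t` (the pendant identity
`T(G) = 2·T(G−y) + T((G−y)^{•s})` at the level of kernels). [this work] -/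
theorem kerTAbs_pendant_zero : ∀ t : CType, kerTAbs t (1, 0, 0) = fC (ctAdd t (1, 0, 0)) + fC t := by decide

/-- The kernel is bounded below by `−5` (finite check; attained at `t = (0,0,1)`, `d = (1,0,0)`). [this work] -/
theorem neg_five_le_kerTAbs : ∀ t d : CType, -5 ≤ kerTAbs t d := by decide

end Kernel

section OnePoint

variable {V : Type*} [Fintype V] (G : SimpleGraph V) (y : V)

/-- `T(G;u,v)` as a double sum over the colourings of `V ∖ {y}` and the colour of `y`, for terminals `u, v ≠ y`. [this work] -/
theorem Tfun_eq_sum_extCol (u v : ({y}ᶜ : Set V)) :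
    Tfun G u.1 v.1 = ∑ τ ∈ univ.filter (fun τ : (({y}ᶜ : Set V)) → Fin 3 => τ u = 0 ∧ τ v = 1),
      ∑ c : Fin 3, fC (ctype G (extCol y τ c)) := by
  rw [Tfun_eq_sum, sum_filter, sum_filter]
  have hR : ∀ τ : (({y}ᶜ : Set V)) → Fin 3,
      (if τ u = 0 ∧ τ v = 1 then ∑ c : Fin 3, fC (ctype G (extCol y τ c)) else 0)
        = ∑ c : Fin 3, (if τ u = 0 ∧ τ v = 1 then fC (ctype G (extCol y τ c)) else 0) := by
    intro τ
    by_cases h : τ u = 0 ∧ τ v = 1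
    · simp only [if_pos h]
    · simp only [if_neg h, sum_const_zero]
  rw [sum_congr rfl (fun τ _ => hR τ), ← Fintype.sum_prod_type']
  refine sum_nbij' (fun σ => (σ ∘ Subtype.val, σ y)) (fun p => extCol y p.1 p.2) (by simp) (by simp)
    (fun σ _ => extCol_restrict y σ) (fun p _ => Prod.ext (extCol_comp_val y p.1 p.2) (extCol_self y p.1 p.2))
    (fun σ _ => ?_)
  dsimp only
  exact if_congr Iff.rfl (by rw [extCol_restrict]) rfl

/-- **`T(G;u,v) − T(G−y;u,v) = Σ_τ K_T(τ)`** over the colourings of `V ∖ {y}` with `τ u = 0`, `τ v = 1`. [this work] -/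
theorem Tfun_sub_Tfun_induce (u v : ({y}ᶜ : Set V)) :
    Tfun G u.1 v.1 - Tfun (G.induce ({y}ᶜ : Set V)) u v
      = ∑ τ ∈ univ.filter (fun τ : (({y}ᶜ : Set V)) → Fin 3 => τ u = 0 ∧ τ v = 1), kerT G y τ := by
  rw [Tfun_eq_sum_extCol G y u v, Tfun_eq_sum]
  unfold kerT
  rw [sum_sub_distrib]
  congr 1
  exact sum_congr (Finset.ext fun τ => by simp only [mem_filter, mem_univ, true_and]) (fun _ _ => rfl)

/-- The same difference with the explicit kernel `kerTAbs (type τ) (profile τ)`. [this work] -/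
theorem Tfun_sub_Tfun_induce_eq_sum_kerTAbs (u v : ({y}ᶜ : Set V)) :
    Tfun G u.1 v.1 - Tfun (G.induce ({y}ᶜ : Set V)) u v
      = ∑ τ ∈ univ.filter (fun τ : (({y}ᶜ : Set V)) → Fin 3 => τ u = 0 ∧ τ v = 1),
          kerTAbs (ctype (G.induce ({y}ᶜ : Set V)) τ) (prof3 G y τ) := by
  rw [Tfun_sub_Tfun_induce]
  exact sum_congr rfl fun τ _ => kerT_eq_kerTAbs G y τ

/-- If every colouring of `V ∖ {y}` (with the terminal colours) sees all three colours on `N(y)`, then `T(G−y) ≤ T(G)` — the trivially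
pointwise case of (VM). [this work] -/
theorem Tfun_induce_le_of_forall_ne_zero (u v : ({y}ᶜ : Set V))
    (h : ∀ τ : (({y}ᶜ : Set V)) → Fin 3, τ u = 0 → τ v = 1 →
      (prof3 G y τ).1 ≠ 0 ∧ (prof3 G y τ).2.1 ≠ 0 ∧ (prof3 G y τ).2.2 ≠ 0) :
    Tfun (G.induce ({y}ᶜ : Set V)) u v ≤ Tfun G u.1 v.1 := by
  rw [← sub_nonneg, Tfun_sub_Tfun_induce_eq_sum_kerTAbs]
  refine sum_nonneg fun τ hτ => ?_
  obtain ⟨h0, h1⟩ := (mem_filter.1 hτ).2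
  obtain ⟨a, b, c⟩ := h τ h0 h1
  exact kerTAbs_nonneg_of_ne_zero _ _ a b c

end OnePoint

/-- **VERTEX-DELETION MONOTONICITY OF THE TWO-TERMINAL FUNCTIONAL (VM)** (this work; OPEN; exact enumeration: 0 failures over all simple
graphs on ≤ 8 vertices — 2 074 128 triples `(G, {u,v}, y)`, connected or not, equality only when both sides vanish — and over all marked
multigraphs on ≤ 6 vertices; kit censuses n = 9 / marks n = 7 queued at write-up): deleting a non-terminal vertex never increases `T`:
`Tfun (G − y) u v ≤ Tfun G u v`.  The pinned (boundary-class) version is FALSE; (VM) implies `Tfun ≥ 0` for every finite graph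
(`Tfun_nonneg_of_vertexMonotone`).  An obligation, never a fact: use as `(h : TfunVertexMonotone)`. [status: open] -/
@[conjecture] def TfunVertexMonotone : Prop :=
  ∀ (V : Type) [Fintype V] (G : SimpleGraph V) (y : V) (u v : ({y}ᶜ : Set V)), u ≠ v →
    Tfun (G.induce ({y}ᶜ : Set V)) u v ≤ Tfun G u.1 v.1

section Base

variable {V : Type*} [Fintype V] (G : SimpleGraph V)

/-- A colouring giving distinct colours to `u` and `v` has no monochromatic edge when every vertex is `u` or `v`. [this work] -/
theorem cnt_eq_zero_of_forall_mem {u v : V} (hV : ∀ w : V, w = u ∨ w = v) {σ : V → Fin 3} (huv : σ u ≠ σ v) (c : Fin 3) :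
    cnt G σ c = 0 := by
  unfold cnt
  rw [card_eq_zero, eq_empty_iff_forall_notMem]
  intro e he
  induction e using Sym2.ind with
  | _ p q =>
    obtain ⟨hadj, hp, hq⟩ := (mk_mem_monoCol_iff G σ c p q).1 he
    have hpq : p ≠ q := hadj.ne
    rcases hV p with rfl | rfl <;> rcases hV q with rfl | rfl
    · exact hpq rfl
    · exact huv (hp.trans hq.symm)
    · exact huv (hq.trans hp.symm)
    · exact hpq rfl

/-- On the two terminals alone the two-terminal functional vanishes. [this work] -/
theorem Tfun_eq_zero_of_forall_mem {u v : V} (hV : ∀ w : V, w = u ∨ w = v) : Tfun G u v = 0 := by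
  rw [Tfun_eq_sum]
  refine sum_eq_zero fun σ hσ => ?_
  obtain ⟨h0, h1⟩ := (mem_filter.1 hσ).2
  have huv : σ u ≠ σ v := by rw [h0, h1]; decide
  have ht : ctype G σ = (0, 0, 0) := by
    unfold ctype
    rw [cnt_eq_zero_of_forall_mem G hV huv 0, cnt_eq_zero_of_forall_mem G hV huv 1, cnt_eq_zero_of_forall_mem G hV huv 2]
    rfl
  rw [ht]
  decide

end Base

/-- **(VM) ⟹ (C\*)**: under vertex-deletion monotonicity the two-terminal functional is nonnegative for EVERY finite graph and every pair
of distinct terminals (no connectivity needed): delete the non-terminal vertices one at a time. [this work] -/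
theorem Tfun_nonneg_of_vertexMonotone (h : TfunVertexMonotone) :
    ∀ (n : ℕ) (V : Type) [Fintype V] (G : SimpleGraph V) (u v : V), Fintype.card V = n → u ≠ v → 0 ≤ Tfun G u v := by
  intro n
  induction n using Nat.strong_induction_on with
  | _ n ih =>
    intro V _ G u v hn huv
    by_cases hV : ∀ w : V, w = u ∨ w = v
    · rw [Tfun_eq_zero_of_forall_mem G hV]
    · push Not at hV
      obtain ⟨y, hyu, hyv⟩ := hV
      let u' : ({y}ᶜ : Set V) := ⟨u, Set.mem_compl_singleton_iff.mpr (Ne.symm hyu)⟩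
      let v' : ({y}ᶜ : Set V) := ⟨v, Set.mem_compl_singleton_iff.mpr (Ne.symm hyv)⟩
      have huv' : u' ≠ v' := fun e => huv (congrArg Subtype.val e)
      have hcard : Fintype.card (({y}ᶜ : Set V)) = n - 1 := by
        rw [Fintype.card_compl_set, Set.card_singleton, hn]
      have hpos : 0 < n := by rw [← hn]; exact Fintype.card_pos_iff.mpr ⟨y⟩
      have hlt : n - 1 < n := Nat.sub_lt hpos Nat.one_pos
      have h1 : 0 ≤ Tfun (G.induce ({y}ᶜ : Set V)) u' v' := ih (n - 1) hlt _ _ u' v' hcard huv'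
      exact h1.trans (h V G y u' v' huv')

/-- **(VM) ⟹ (C)**: in particular vertex-deletion monotonicity implies the two-terminal inequality `TwoTerminalC` (p416807). [this work] -/
theorem twoTerminalC_of_vertexMonotone (h : TfunVertexMonotone) : TwoTerminalC := by
  intro V _ G u v huv _
  exact Tfun_nonneg_of_vertexMonotone h (Fintype.card V) V G u v rfl huv

end Summit.CriticalPhenomena.PercolationContinuityZ3.Theorems.SunflowerPartition.Kempe
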